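import Mathlib
import HarnessLib
import Summits.HubbardSuperconductivity.HubbardSuperconductivity.Theorems.KLProgrammeKLRegimeEngineV8TwoLegGridMomentsFrameBase

/-!
# Route `KLProgramme` — ENGINE child gen 8 (stmt-HubbardSuperconductivity-20437 `KLRegimeEngineV17F2`), class #7 in GRID currency, located risk #9
# («(b)-GRID-FRAME-M1», pen (R59bd)/(R59be), menu (T) ≻ (C2) ≻ (c)): the SPACE row of the scale-0 frame-`K` base of the grid atom in the
# `U`-free `ĉ`-CURRENCY of option (T) — p564283's certified floor fits once `ĉ ≥ (Nsc+1)·U²`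

Cell gate-hubbard-kl, seat hubbard-kl-k3c2-p1 g8 (row «scale-0 Gram step»; (T)-checker (i) of (R59bd)).  k3c2-p3's frame-`K` base
`twoLegGridMomentsAt_scaleZero_of_frameOK_linear` (p564283) gives the SPACE row of `TwoLegGridMomentsAt … K 0` as
`8e²a·(4e⁴f + 16e⁸κ₀²)²·U²·β/(2N)` at the certified `f = κ_R + 2(Nsc+1)|U|·m_R`; with `(4e⁴f + 16e⁸κ₀²)|U| = (4e⁴κ_R + 16e⁸κ₀²)|U| + 8e⁴m_R·(Nsc+1)U²`,
`(x+y)² ≤ 2x² + 2y²` and `U² ≤ (Nsc+1)U² ≤ ĉ`: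

* `chat_budget_arith`, `chat_small_arith` — the two polynomial inequalities (atoms `e, a, κ_R, m_R, κ₀², Nsc+1, ĉ, U`);
* **`twoLegGrid_space_row_scaleZero_of_frameOK_chat`** — under p564283's binders, ANY `ĉ ≥ (Nsc+1)·U²` and the smallness
  `e·a·((4e⁴κ_R + 16e⁸κ₀²)|U| + 8e⁴m_R·ĉ) ≤ 1/2` (a `U ≤ U₀(R,a)` ∧ `ĉ ≤ ĉ₀(R,a)` condition, no `1/U`): the SPACE row is
  `≤ (16e²(4e⁴κ_R + 16e⁸κ₀²)² + 1024e¹⁰m_R²·ĉ)·a·ĉ·β/(2N)`, `m_R = 6(πGfr₁/2 + π²Gfr₂/(2√2) + π³Gfr₃/8)`; at regime depth take `ĉ = c/log 4`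
  (`nScales_succ_mul_sq_le`).  The TIME row in pure `U²` currency is the sibling file `…FrameBaseTime`.

Raw row inequality only (the re-keyed atom text is the class-#7 owner's); proofs only; no definitions; nothing about the model's sizes is asserted;
nothing asserts superconductivity.  `--supports stmt-HubbardSuperconductivity-20437`.
References: BGM 2006 §2.3 (2.17), §3 (3.2)–(3.8) [cite: BenfattoGiulianiMastropietro2006]; Pedra–Salmhofer 2008 Thm 2.4 [cite: PedraSalmhofer2008].
-/

noncomputable section

namespace Summit.HubbardSuperconductivity.HubbardSuperconductivity.Theorems.EngineV8

set_option linter.dupNamespace false -- summit = problem name (single-conjunct summit), D-0017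

open Real Finset Literature.MathematicalPhysics.QuantumLattice Literature.Probability.LatticeModels
open Literature.Probability.LatticeModels.BattleFederbush GrassmannAlgebra
open Summit.HubbardSuperconductivity.HubbardSuperconductivity.Theorems.KLRegimeSplit
open Summit.HubbardSuperconductivity.HubbardSuperconductivity.Theorems.KLProgrammeLegKernels

section FrameBaseChat

variable {L M : ℕ} [NeZero L] [NeZero M] {R : RenConsts} {μ U β : ℝ} {Nsc : ℕ} {K : TrigPolyC4v}

omit [NeZero L] [NeZero M] in
/-- Arithmetic of the `ĉ`-currency: with `A = 4e⁴k_R + 16e⁸k₀`, `B = 8e⁴m_R`, `t = n₁U² ≤ ĉ` (`n₁ ≥ 1`, so `U² ≤ ĉ`):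
`8e²a·(A + B·n₁|U|)²·U²·w = 8e²a·(A|U| + B·t)²·w ≤ (16e²A² + 1024e¹⁰m_R²ĉ)·a·ĉ·w`. -/
theorem chat_budget_arith {e a kR mR k0 n1 ĉ w U : ℝ} (ha : 0 ≤ a) (hn1 : 1 ≤ n1) (ht : n1 * U ^ 2 ≤ ĉ)
    (hw : 0 ≤ w) :
    8 * e ^ 2 * a * (4 * e ^ 4 * (kR + 2 * (n1 * |U| * mR)) + 16 * e ^ 8 * k0) ^ 2 * U ^ 2 * w ≤
      (16 * e ^ 2 * (4 * e ^ 4 * kR + 16 * e ^ 8 * k0) ^ 2 + 1024 * e ^ 10 * mR ^ 2 * ĉ) * a * ĉ * w := by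
  have hu2 : |U| ^ 2 = U ^ 2 := sq_abs U
  have ht0 : 0 ≤ n1 * U ^ 2 := mul_nonneg (by linarith) (sq_nonneg U)
  have hU2 : U ^ 2 ≤ ĉ := (le_mul_of_one_le_left (sq_nonneg U) hn1).trans ht
  have hĉ0 : 0 ≤ ĉ := (sq_nonneg U).trans hU2
  -- `(A + B n₁|U|)²·U² = (A|U| + B·t)²`
  have hid : (4 * e ^ 4 * (kR + 2 * (n1 * |U| * mR)) + 16 * e ^ 8 * k0) ^ 2 * U ^ 2 =
      ((4 * e ^ 4 * kR + 16 * e ^ 8 * k0) * |U| + 8 * e ^ 4 * mR * (n1 * U ^ 2)) ^ 2 := by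
    rw [← hu2]; ring
  -- `(p + q)² ≤ 2p² + 2q²`, `p² = A²U² ≤ A²ĉ`, `q² = B²t² ≤ B²ĉ²`
  have h1 : ((4 * e ^ 4 * kR + 16 * e ^ 8 * k0) * |U| + 8 * e ^ 4 * mR * (n1 * U ^ 2)) ^ 2 ≤
      2 * ((4 * e ^ 4 * kR + 16 * e ^ 8 * k0) * |U|) ^ 2 + 2 * (8 * e ^ 4 * mR * (n1 * U ^ 2)) ^ 2 := by
    nlinarith [sq_nonneg ((4 * e ^ 4 * kR + 16 * e ^ 8 * k0) * |U| - 8 * e ^ 4 * mR * (n1 * U ^ 2))]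
  have h2 : ((4 * e ^ 4 * kR + 16 * e ^ 8 * k0) * |U|) ^ 2 ≤ (4 * e ^ 4 * kR + 16 * e ^ 8 * k0) ^ 2 * ĉ := by
    rw [mul_pow, hu2]
    exact mul_le_mul_of_nonneg_left hU2 (sq_nonneg _)
  have h3 : (8 * e ^ 4 * mR * (n1 * U ^ 2)) ^ 2 ≤ (8 * e ^ 4 * mR) ^ 2 * (ĉ * ĉ) := by
    rw [mul_pow]
    refine mul_le_mul_of_nonneg_left ?_ (sq_nonneg _)
    rw [sq]
    exact mul_le_mul ht ht ht0 hĉ0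
  have h4 : (4 * e ^ 4 * (kR + 2 * (n1 * |U| * mR)) + 16 * e ^ 8 * k0) ^ 2 * U ^ 2 ≤
      (2 * (4 * e ^ 4 * kR + 16 * e ^ 8 * k0) ^ 2 + 2 * (8 * e ^ 4 * mR) ^ 2 * ĉ) * ĉ := by
    rw [hid]
    refine h1.trans ?_
    have := add_le_add (mul_le_mul_of_nonneg_left h2 (zero_le_two (α := ℝ))) (mul_le_mul_of_nonneg_left h3 (zero_le_two (α := ℝ)))
    refine this.trans (le_of_eq ?_)
    ring
  have h8 : 0 ≤ 8 * e ^ 2 * a := by positivity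
  calc 8 * e ^ 2 * a * (4 * e ^ 4 * (kR + 2 * (n1 * |U| * mR)) + 16 * e ^ 8 * k0) ^ 2 * U ^ 2 * w
      = 8 * e ^ 2 * a * ((4 * e ^ 4 * (kR + 2 * (n1 * |U| * mR)) + 16 * e ^ 8 * k0) ^ 2 * U ^ 2) * w := by ring
    _ ≤ 8 * e ^ 2 * a * ((2 * (4 * e ^ 4 * kR + 16 * e ^ 8 * k0) ^ 2 + 2 * (8 * e ^ 4 * mR) ^ 2 * ĉ) * ĉ) * w :=
        mul_le_mul_of_nonneg_right (mul_le_mul_of_nonneg_left h4 h8) hw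
    _ = (16 * e ^ 2 * (4 * e ^ 4 * kR + 16 * e ^ 8 * k0) ^ 2 + 1024 * e ^ 10 * mR ^ 2 * ĉ) * a * ĉ * w := by ring

omit [NeZero L] [NeZero M] in
/-- The smallness conversion of the `ĉ`-currency: `e·a·|U|·(A + B·n₁|U|) = e·a·(A|U| + B·t) ≤ e·a·(A|U| + B·ĉ)` for `t = n₁U² ≤ ĉ`. -/
theorem chat_small_arith {e a kR mR k0 n1 ĉ U : ℝ} (he : 0 ≤ e) (ha : 0 ≤ a) (hmR : 0 ≤ mR) (ht : n1 * U ^ 2 ≤ ĉ) :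
    e * a * |U| * (4 * e ^ 4 * (kR + 2 * (n1 * |U| * mR)) + 16 * e ^ 8 * k0) ≤
      e * a * ((4 * e ^ 4 * kR + 16 * e ^ 8 * k0) * |U| + 8 * e ^ 4 * mR * ĉ) := by
  have hu2 : |U| * |U| = U ^ 2 := by rw [← sq_abs]; ring
  have hid : e * a * |U| * (4 * e ^ 4 * (kR + 2 * (n1 * |U| * mR)) + 16 * e ^ 8 * k0) =
      e * a * ((4 * e ^ 4 * kR + 16 * e ^ 8 * k0) * |U| + 8 * e ^ 4 * mR * (n1 * U ^ 2)) := by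
    rw [← hu2]; ring
  rw [hid]
  have hB : 8 * e ^ 4 * mR * (n1 * U ^ 2) ≤ 8 * e ^ 4 * mR * ĉ := mul_le_mul_of_nonneg_left ht (by positivity)
  exact mul_le_mul_of_nonneg_left (by linarith) (by positivity)

/-- **THE SPACE ROW OF THE GRID ATOM AT `(K, 0)` FOR AN ADMISSIBLE FRAME, IN `ĉ`-CURRENCY** (p564283's binders; ANY `ĉ ≥ (Nsc+1)·U²`, hence
`ĉ ≥ U²`; smallness `e·a·((4e⁴κ_R + 16e⁸κ₀²)|U| + 8e⁴m_R·ĉ) ≤ 1/2`): for both spins and every grid pin `p₀`,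
`Σ_{p₁} [x⃗₁ ≠ x⃗₀](1+|Δx̃₀|+|Δx̃₁|)·‖kernel₂ (W_0[K] − 𝒩_{K,N}) ((p₀,σ,+),(p₁,σ,−))‖ ≤ (16e²(4e⁴κ_R + 16e⁸κ₀²)² + 1024e¹⁰m_R²·ĉ)·a·ĉ·β/(2N)`,
`m_R = 6(πGfr₁/2 + π²Gfr₂/(2√2) + π³Gfr₃/8)` — p564283 `_linear` (certified `F = κ_R|U| + 2(Nsc+1)U²m_R`), `(x+y)² ≤ 2x² + 2y²` and `U² ≤ ĉ`.
At regime depth (`(nScales β + 1)·U² ≤ c/log 4`, `nScales_succ_mul_sq_le`) take `ĉ = c/log 4`. -/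
theorem twoLegGrid_space_row_scaleZero_of_frameOK_chat (hK : FrameOK R U Nsc μ K) (hR : R.WF) (hU : 0 < U) (hU1 : |U| ≤ 1)
    (hβ : klBetaMin ≤ β) (hL : klEngL₃ β U ≤ L) (hM : klEngM₃ β U L ≤ M) {a : ℝ} (ha : 0 < a)
    (hA : klScaleZeroA0 + uvTimeMomentConst klE0 7 32 +
          2 * (uvSpaceMomentConst klE0 1 (uvPieceSq klE0 (uvBaseQ klCutoffX5 klE0 4) (uvBaseQ' klCutoffX5 klE0 4)) +
            (1 / 4 * Real.sqrt (216 * (1 / klE0 + 1 / 2)) *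
                ∑ e : Fin 2 × Fin 2, (uvLinV klE0 (1 + (e.1 : ℕ) + (e.2 : ℕ)) *
                    (klCutoffX5 * ((1 + ((e.1 : ℕ) + (e.2 : ℕ)) + 2).factorial : ℝ) * (4 / klE0) ^ (1 + ((e.1 : ℕ) + (e.2 : ℕ)) + 1)) +
                  uvLinD klE0 (1 + (e.1 : ℕ) + (e.2 : ℕ)) *
                    (klCutoffX5 * ((1 + ((e.1 : ℕ) + (e.2 : ℕ)) + 3).factorial : ℝ) * (4 / klE0) ^ (1 + ((e.1 : ℕ) + (e.2 : ℕ)) + 2)))) *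
              (4608 * (1 + R.Gfr 0 + R.Gfr 1 + R.Gfr 2 + R.Gfr 3) ^ 4 * (((Nsc : ℝ) + 1) * U ^ 2 + 2 * |U|))) ≤ a)
    {ĉ : ℝ} (hĉ : ((Nsc : ℝ) + 1) * U ^ 2 ≤ ĉ)
    (hsmall : Real.exp 1 * a *
      ((4 * Real.exp 1 ^ 4 * (256 * ((4 / 3) * Real.sqrt (24 * π ^ 2 * (R.Gfr 0 + 1) * (R.Gfr 2 + 1)) + (128 / 15) * (R.Gfr 0 + 1))) +
          16 * Real.exp 1 ^ 8 * Real.sqrt (2 * (7 + 1606732)) ^ 2) * |U| +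
        8 * Real.exp 1 ^ 4 * (6 * (Real.pi * R.Gfr 1 / 2 + Real.pi ^ 2 * R.Gfr 2 / (2 * Real.sqrt 2) + Real.pi ^ 3 * R.Gfr 3 / 8)) * ĉ) ≤ 1 / 2)
    (σ : Fin 2) (p₀ : GridPoint L (2 * (2 * M))) :
    ∑ p₁ : GridPoint L (2 * (2 * M)),
      (if p₁.2 - p₀.2 = 0 then (0 : ℝ) else
        (1 + (((p₁.2 - p₀.2) 0).valMinAbs.natAbs : ℝ) + (((p₁.2 - p₀.2) 1).valMinAbs.natAbs : ℝ)) ^ 1) *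
        ‖kernel ℂ
          (effAction ℂ ((hubbardGridSub L M β (2 * (2 * M))).transpose *
              hubbardCovAboveCT L M β μ 0 K (klScale klE0 0) * hubbardGridSub L M β (2 * (2 * M)))
            (hubbardGridInteraction L (2 * (2 * M)) β U + hubbardGridCounterQuadratic L (2 * (2 * M)) β K) -
            hubbardGridCounterQuadratic L (2 * (2 * M)) β K) 2
          (fun i => ((![p₀, p₁] i, σ), i))‖ ≤
      (16 * Real.exp 1 ^ 2 *
          (4 * Real.exp 1 ^ 4 * (256 * ((4 / 3) * Real.sqrt (24 * π ^ 2 * (R.Gfr 0 + 1) * (R.Gfr 2 + 1)) + (128 / 15) * (R.Gfr 0 + 1))) +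
            16 * Real.exp 1 ^ 8 * Real.sqrt (2 * (7 + 1606732)) ^ 2) ^ 2 +
        1024 * Real.exp 1 ^ 10 * (6 * (Real.pi * R.Gfr 1 / 2 + Real.pi ^ 2 * R.Gfr 2 / (2 * Real.sqrt 2) + Real.pi ^ 3 * R.Gfr 3 / 8)) ^ 2 * ĉ) *
        a * ĉ * (β / (2 * ((2 * (2 * M) : ℕ) : ℝ))) := by
  haveI : NeZero (2 * (2 * M)) := ⟨by have := NeZero.ne M; omega⟩
  have hβ0 : 0 < β := lt_of_lt_of_le (by norm_num [klBetaMin]) hβ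
  have hw : 0 ≤ β / (2 * ((2 * (2 * M) : ℕ) : ℝ)) := by positivity
  have hG : ∀ j, 0 ≤ R.Gfr j := hR.2.2
  have he : 0 ≤ Real.exp 1 := (Real.exp_pos 1).le
  have hmR : 0 ≤ 6 * (Real.pi * R.Gfr 1 / 2 + Real.pi ^ 2 * R.Gfr 2 / (2 * Real.sqrt 2) + Real.pi ^ 3 * R.Gfr 3 / 8) := by
    have := hG 1; have := hG 2; have := hG 3; positivity
  have hn1 : (1 : ℝ) ≤ (Nsc : ℝ) + 1 := by have := Nat.cast_nonneg (α := ℝ) Nsc; linarith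
  -- p564283's smallness from ours, then its space row at the certified `F`
  have hsmall' := (chat_small_arith (kR := 256 * ((4 / 3) * Real.sqrt (24 * π ^ 2 * (R.Gfr 0 + 1) * (R.Gfr 2 + 1)) + (128 / 15) * (R.Gfr 0 + 1)))
    (k0 := Real.sqrt (2 * (7 + 1606732)) ^ 2) he ha.le hmR hĉ).trans hsmall
  have h := (twoLegGridMomentsAt_scaleZero_of_frameOK_linear hK hR hU hU1 hβ hL hM ha hA hsmall').2 σ p₀
  exact h.trans (chat_budget_arith ha.le hn1 hĉ hw)

end FrameBaseChat

end Summit.HubbardSuperconductivity.HubbardSuperconductivity.Theorems.EngineV8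

end
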